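import Summits.QuantumFields.YangMills.Theorems.ColdStartUniversalityUniformColdStartMixingChiSquareStep
import HarnessLib

/-!
# Route `ColdStartUniversality`, crux K_A1 (stmt-QuantumFields-24809), line «cold_entropy»: the χ² BUDGET (H2 of `chiSquareStep`)
# IMPLIES the ENTROPY BUDGET `stub_coldEntropyBudget` — `KL ≤ χ²`, kernel-checked

Helper file (seat `ym-line-csu-p1`, g16; `--supports stmt-QuantumFields-24809`).  Makes the accounting of `…ChiSquareStep` a theorem:
the L² twin trades a WEAKER functional inequality (Poincaré instead of log-Sobolev) for a STRONGER warm-start budget — the dual-form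
χ² budget implies the entropy budget with `H₀ := X₀` at the same `γ₁, s₀, K₀`.

Abstract measure theory (any measurable space, probability measures `ν, μ`, `X₀ ≥ 0`), hypothesis in DUAL form
`(∫ G dν − ∫ G dμ)² ≤ X₀ ∫ (G − μG)² dμ` for all measurable `|G| ≤ 1`:
* `absolutelyContinuous_of_dual_sq_le` — `ν ≪ μ` (test indicators of null sets);
* `lintegral_rnDeriv_sub_one_sq_le_of_dual` — `χ²(ν‖μ) = ∫ (dν/dμ − 1)² dμ ≤ X₀` (Riesz by truncation: test `G = (h−1)·1_{|h−1|≤n}`,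
  monotone convergence);
* `klFun_le_sub_one_sq` — `x log x + 1 − x ≤ (x − 1)²` on `[0, ∞)` (`log x ≤ x − 1`);
* ★ `klDiv_le_of_dual_sq_le` — `KL(ν‖μ) ≤ X₀`;
* ★★ `coldEntropyBudget_of_coldChiSquareBudget` — (H2) ⇒ the node `ColdEntropyBudget` of the registered line VERBATIM (transport
  through the bond dictionary by composition, `gibbsMeasure = μ_K ∘ dict⁻¹`).

THEOREMS ONLY, no definition, no sorry.  HONEST FRAMING: an implication between HYPOTHESES of two decompositions of the crux; nothing
K-uniform is proved; no rung of the ladder, crux or summit statement is proved; the Yang–Mills mass gap is NOT proved.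
-/

set_option autoImplicit false

noncomputable section

namespace Summit.QuantumFields.YangMills.Theorems.ColdStartUniversality

open MeasureTheory ProbabilityTheory InformationTheory
open scoped NNReal ENNReal
open Literature.Probability.Process Literature.MathematicalPhysics.QuantumFieldTheory
open Literature.MathematicalPhysics.QuantumLattice (fundamentalRep fundamentalLatticeRep continuous_fundamentalRep)
open Literature.MathematicalPhysics.QuantumFieldTheory.Balaban1983to89

/-! ## Abstract: a dual χ² bound gives absolute continuity, `χ² ≤ X₀` and `KL ≤ X₀` -/

section Abstract

variable {α : Type*} [MeasurableSpace α] {ν μ : Measure α} [IsProbabilityMeasure ν] [IsProbabilityMeasure μ] {X₀ : ℝ}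

omit [IsProbabilityMeasure μ] in
/-- A dual χ² bound forces absolute continuity: test the indicator of a `μ`-null set. [folklore] -/
theorem absolutelyContinuous_of_dual_sq_le
    (h : ∀ G : α → ℝ, Measurable G → (∀ x, |G x| ≤ 1) →
      ((∫ x, G x ∂ν) - ∫ x, G x ∂μ) ^ 2 ≤ X₀ * ∫ x, (G x - ∫ z, G z ∂μ) ^ 2 ∂μ) : ν ≪ μ := by
  refine Measure.AbsolutelyContinuous.mk fun s hs hμs => ?_
  have hG := h (s.indicator (1 : α → ℝ)) (measurable_one.indicator hs) (fun x => by
    by_cases hx : x ∈ s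
    · simp [Set.indicator_of_mem hx]
    · simp [Set.indicator_of_notMem hx])
  have hμint : ∫ x, s.indicator (1 : α → ℝ) x ∂μ = 0 := by
    rw [integral_indicator_one hs, Measure.real, hμs, ENNReal.toReal_zero]
  have hvar : ∫ x, (s.indicator (1 : α → ℝ) x - ∫ z, s.indicator (1 : α → ℝ) z ∂μ) ^ 2 ∂μ = 0 := by
    rw [hμint]
    have hae : (fun x => (s.indicator (1 : α → ℝ) x - 0) ^ 2) =ᵐ[μ] fun _ => 0 := by
      have hs0 : ∀ᵐ x ∂μ, x ∉ s := by
        rw [ae_iff]; simpa using hμs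
      filter_upwards [hs0] with x hx
      simp [Set.indicator_of_notMem hx]
    rw [integral_congr_ae hae, integral_zero]
  rw [hvar, mul_zero, hμint, sub_zero, integral_indicator_one hs] at hG
  have h0 : ν.real s = 0 := by nlinarith [sq_nonneg (ν.real s)]
  exact (measureReal_eq_zero_iff (measure_ne_top ν s)).1 h0

/-- `klFun x = x log x + 1 − x ≤ (x − 1)²` for `x ≥ 0` (`log x ≤ x − 1`). [folklore] -/
theorem klFun_le_sub_one_sq {x : ℝ} (hx : 0 ≤ x) : klFun x ≤ (x - 1) ^ 2 := by
  rw [klFun_apply]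
  rcases hx.eq_or_lt with h0 | hpos
  · rw [← h0]; simp
  · have hlog : Real.log x ≤ x - 1 := Real.log_le_sub_one_of_pos hpos
    nlinarith [mul_le_mul_of_nonneg_left hlog hpos.le]

/-- **`χ² ≤ X₀` from the dual bound** (Riesz by truncation): with `h = dν/dμ`,
`∫⁻ (h − 1)² dμ ≤ X₀`. [folklore] -/
theorem lintegral_rnDeriv_sub_one_sq_le_of_dual (hX₀ : 0 ≤ X₀)
    (h : ∀ G : α → ℝ, Measurable G → (∀ x, |G x| ≤ 1) →
      ((∫ x, G x ∂ν) - ∫ x, G x ∂μ) ^ 2 ≤ X₀ * ∫ x, (G x - ∫ z, G z ∂μ) ^ 2 ∂μ) :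
    ∫⁻ x, ENNReal.ofReal (((ν.rnDeriv μ x).toReal - 1) ^ 2) ∂μ ≤ ENNReal.ofReal X₀ := by
  have hac : ν ≪ μ := absolutelyContinuous_of_dual_sq_le h
  set p : α → ℝ := fun x => (ν.rnDeriv μ x).toReal with hp
  have hpm : Measurable p := (ν.measurable_rnDeriv μ).ennreal_toReal
  -- the hypothesis extends to every bounded measurable `G` (scaling)
  have h' : ∀ G : α → ℝ, Measurable G → ∀ M : ℝ, 0 < M → (∀ x, |G x| ≤ M) →
      ((∫ x, G x ∂ν) - ∫ x, G x ∂μ) ^ 2 ≤ X₀ * ∫ x, (G x - ∫ z, G z ∂μ) ^ 2 ∂μ := by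
    intro G hG M hM hGM
    have h1 := h (fun x => G x / M) (hG.div_const M) (fun x => by
      rw [abs_div, abs_of_pos hM, div_le_one hM]; exact hGM x)
    have e1 : ∫ x, G x / M ∂ν = (∫ x, G x ∂ν) / M := integral_div M _
    have e2 : ∫ x, G x / M ∂μ = (∫ x, G x ∂μ) / M := integral_div M _
    have e3 : ∫ x, (G x / M - (∫ z, G z ∂μ) / M) ^ 2 ∂μ = (∫ x, (G x - ∫ z, G z ∂μ) ^ 2 ∂μ) / M ^ 2 := by
      have : ∀ x, (G x / M - (∫ z, G z ∂μ) / M) ^ 2 = (G x - ∫ z, G z ∂μ) ^ 2 / M ^ 2 := fun x => by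
        rw [← sub_div, div_pow]
      simp_rw [this]
      exact integral_div _ _
    rw [e1, e2, e3, ← sub_div, div_pow] at h1
    have hM2 : 0 < M ^ 2 := by positivity
    rw [div_le_iff₀ hM2] at h1
    calc ((∫ x, G x ∂ν) - ∫ x, G x ∂μ) ^ 2 ≤ X₀ * ((∫ x, (G x - ∫ z, G z ∂μ) ^ 2 ∂μ) / M ^ 2) * M ^ 2 := h1
      _ = X₀ * ∫ x, (G x - ∫ z, G z ∂μ) ^ 2 ∂μ := by field_simp
  -- truncations `ψ_n = (p − 1)·1_{|p−1| ≤ n}`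
  set ψ : ℕ → α → ℝ := fun n x => if |p x - 1| ≤ (n : ℝ) then p x - 1 else 0 with hψ
  have hψm : ∀ n, Measurable (ψ n) := fun n =>
    Measurable.ite (measurableSet_le ((hpm.sub measurable_const).abs) measurable_const) (hpm.sub measurable_const)
      measurable_const
  have hψb : ∀ n x, |ψ n x| ≤ (n : ℝ) + 1 := by
    intro n x
    by_cases hx : |p x - 1| ≤ (n : ℝ)
    · simp only [hψ, if_pos hx]; linarith
    · simp only [hψ, if_neg hx, abs_zero]; positivity
  have hψi : ∀ n, Integrable (ψ n) μ := fun n =>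
    (integrable_const ((n : ℝ) + 1)).mono' (hψm n).aestronglyMeasurable
      (ae_of_all _ fun x => by rw [Real.norm_eq_abs]; exact hψb n x)
  have hψ2i : ∀ n, Integrable (fun x => (ψ n x) ^ 2) μ := fun n =>
    (integrable_const (((n : ℝ) + 1) ^ 2)).mono' ((hψm n).pow_const 2).aestronglyMeasurable
      (ae_of_all _ fun x => by
        rw [Real.norm_eq_abs, abs_pow]; exact pow_le_pow_left₀ (abs_nonneg _) (hψb n x) 2)
  -- `(p − 1) ψ_n = ψ_n²`
  have hkey : ∀ n x, (p x - 1) * ψ n x = (ψ n x) ^ 2 := by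
    intro n x
    by_cases hx : |p x - 1| ≤ (n : ℝ)
    · simp only [hψ, if_pos hx]; ring
    · simp only [hψ, if_neg hx]; ring
  -- `∫ ψ_n dν − ∫ ψ_n dμ = ∫ ψ_n² dμ`
  have hpair : ∀ n, (∫ x, ψ n x ∂ν) - ∫ x, ψ n x ∂μ = ∫ x, (ψ n x) ^ 2 ∂μ := by
    intro n
    have hνψ : ∫ x, ψ n x ∂ν = ∫ x, p x * ψ n x ∂μ := (integral_toReal_rnDeriv_mul hac).symm
    have hpψ : Integrable (fun x => p x * ψ n x) μ := by
      have e : (fun x => p x * ψ n x) = fun x => (ψ n x) ^ 2 + ψ n x := by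
        funext x; have := hkey n x; linear_combination this
      rw [e]; exact (hψ2i n).add (hψi n)
    rw [hνψ, ← integral_sub hpψ (hψi n)]
    refine integral_congr_ae (ae_of_all _ fun x => ?_)
    show p x * ψ n x - ψ n x = ψ n x ^ 2
    have := hkey n x; linear_combination this
  -- `∫ ψ_n² dμ ≤ X₀`
  have hbound : ∀ n, ∫ x, (ψ n x) ^ 2 ∂μ ≤ X₀ := by
    intro n
    set A : ℝ := ∫ x, (ψ n x) ^ 2 ∂μ with hA
    have hA0 : 0 ≤ A := integral_nonneg fun x => sq_nonneg _
    have h1 := h' (ψ n) (hψm n) ((n : ℝ) + 1) (by positivity) (hψb n)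
    rw [hpair n] at h1
    -- `Var(ψ_n) ≤ ∫ ψ_n²`
    have hvar : ∫ x, (ψ n x - ∫ z, ψ n z ∂μ) ^ 2 ∂μ ≤ A := by
      have hLp : MemLp (ψ n) 2 μ := MemLp.of_bound (hψm n).aestronglyMeasurable ((n : ℝ) + 1)
        (ae_of_all _ fun x => by rw [Real.norm_eq_abs]; exact hψb n x)
      have hv : variance (ψ n) μ = ∫ x, (ψ n x - ∫ z, ψ n z ∂μ) ^ 2 ∂μ := variance_eq_integral (hψm n).aemeasurable
      rw [← hv, variance_eq_sub hLp]
      have e : μ[(ψ n) ^ 2] = A := rfl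
      rw [e]; nlinarith [sq_nonneg (μ[ψ n])]
    have h2 : A ^ 2 ≤ X₀ * A := h1.trans (mul_le_mul_of_nonneg_left hvar hX₀)
    rcases hA0.eq_or_lt with hz | hpos
    · rw [← hz]; exact hX₀
    · nlinarith
  -- monotone convergence
  have hmono : Monotone fun n => fun x => ENNReal.ofReal ((ψ n x) ^ 2) := by
    intro n m hnm x
    refine ENNReal.ofReal_le_ofReal ?_
    by_cases hx : |p x - 1| ≤ (n : ℝ)
    · have hx' : |p x - 1| ≤ (m : ℝ) := hx.trans (by exact_mod_cast hnm)
      simp only [hψ, if_pos hx, if_pos hx', le_refl]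
    · have e0 : ψ n x = 0 := by simp only [hψ, if_neg hx]
      rw [e0]
      norm_num
      exact sq_nonneg _
  have hsup : ∀ x, (⨆ n : ℕ, ENNReal.ofReal ((ψ n x) ^ 2)) = ENNReal.ofReal ((p x - 1) ^ 2) := by
    intro x
    apply le_antisymm
    · refine iSup_le fun n => ENNReal.ofReal_le_ofReal ?_
      by_cases hx : |p x - 1| ≤ (n : ℝ)
      · simp only [hψ, if_pos hx, le_refl]
      · have e0 : ψ n x = 0 := by simp only [hψ, if_neg hx]
        rw [e0]; norm_num; exact sq_nonneg _
    · obtain ⟨n, hn⟩ := exists_nat_ge |p x - 1|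
      refine le_iSup_of_le n (ENNReal.ofReal_le_ofReal ?_)
      simp only [hψ, if_pos hn, le_refl]
  calc ∫⁻ x, ENNReal.ofReal ((p x - 1) ^ 2) ∂μ = ∫⁻ x, ⨆ n : ℕ, ENNReal.ofReal ((ψ n x) ^ 2) ∂μ := by
        simp_rw [hsup]
    _ = ⨆ n : ℕ, ∫⁻ x, ENNReal.ofReal ((ψ n x) ^ 2) ∂μ :=
        lintegral_iSup (fun n => ((hψm n).pow_const 2).ennreal_ofReal) hmono
    _ ≤ ENNReal.ofReal X₀ := by
        refine iSup_le fun n => ?_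
        rw [← ofReal_integral_eq_lintegral_ofReal (hψ2i n) (ae_of_all _ fun x => sq_nonneg _)]
        exact ENNReal.ofReal_le_ofReal (hbound n)

/-- ★ **`KL(ν‖μ) ≤ X₀` from the dual χ² bound** (`klFun ≤ (·−1)²` and `χ² ≤ X₀`). [folklore] -/
theorem klDiv_le_of_dual_sq_le (hX₀ : 0 ≤ X₀)
    (h : ∀ G : α → ℝ, Measurable G → (∀ x, |G x| ≤ 1) →
      ((∫ x, G x ∂ν) - ∫ x, G x ∂μ) ^ 2 ≤ X₀ * ∫ x, (G x - ∫ z, G z ∂μ) ^ 2 ∂μ) :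
    klDiv ν μ ≤ ENNReal.ofReal X₀ := by
  have hac : ν ≪ μ := absolutelyContinuous_of_dual_sq_le h
  rw [klDiv_eq_lintegral_klFun_of_ac hac]
  refine le_trans (lintegral_mono fun x => ENNReal.ofReal_le_ofReal (klFun_le_sub_one_sq ENNReal.toReal_nonneg)) ?_
  exact lintegral_rnDeriv_sub_one_sq_le_of_dual hX₀ h

end Abstract

/-! ## The χ² budget implies the entropy budget of line «cold_entropy» -/

/-- ★★ **(H2) ⇒ `ColdEntropyBudget`**: the K-uniform cold-start χ² budget in dual form (hypothesis (H2) of `chiSquareStep`) implies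
the node `ColdEntropyBudget` (= registered `stub_coldEntropyBudget`, statement verbatim as the first hypothesis of `pinskerStep`) with
the same `γ₁, s₀, K₀` and `H₀ := X₀` — transport through the bond dictionary (`gibbsMeasure = μ_K.map dict`,
`gibbsMeasure_eq_map_wilsonMeasure`) and `klDiv_le_of_dual_sq_le`. [folklore] -/
theorem coldEntropyBudget_of_coldChiSquareBudget :
    (∃ γ₁ : ℝ, 0 < γ₁ ∧ ∀ (F : T3ContinuumYM3Torus.T3Family) (γ : ℝ), 0 < γ → γ ≤ γ₁ →
      ∃ s₀ X₀ : ℝ, 0 < s₀ ∧ 0 ≤ X₀ ∧ ∃ K₀ : ℕ, ∀ K : ℕ, K₀ ≤ K →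
        ∀ (Ω : Type) (mΩ : MeasurableSpace Ω) (P : Measure Ω) (_ : IsProbabilityMeasure P)
          (W : ℝ≥0 → Ω → (Edge 3 ((F.P K).sitesPerDir 0) × NoiseIdx 2 → ℝ)) (hW : IsFlatBrownian W P)
          (U : ℝ≥0 → Ω → GaugeConfig 3 ((F.P K).sitesPerDir 0) (Matrix.specialUnitaryGroup (Fin 2) ℂ)),
          ((∀ ω, U 0 ω = fun _ => 1) ∧
            (latticeLangevinDynamics (⟨2, fundamentalRep (Fin 2), continuous_fundamentalRep _,
                Literature.MathematicalPhysics.QuantumLattice.fundamentalRep_injective _,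
                Literature.MathematicalPhysics.QuantumLattice.fundamentalRep_mem_unitaryGroup⟩ :
                LatticeRep (Matrix.specialUnitaryGroup (Fin 2) ℂ)) ((γ * (F.P K).eps)⁻¹ / 2)).IsSolution
              (fundamentalRep (Fin 2)) hW.natFiltration P W U) →
          ∀ (G : GaugeConfig 3 ((F.P K).sitesPerDir 0) (Matrix.specialUnitaryGroup (Fin 2) ℂ) → ℝ), Measurable G →
            (∀ x, |G x| ≤ 1) →
            ((∫ ω, G (U (s₀ / (F.P K).eps).toNNReal ω) ∂P) - ∫ z, G z ∂(wilsonMeasure (d := 3) (L := (F.P K).sitesPerDir 0)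
                (fundamentalRep (Fin 2)) ((γ * (F.P K).eps)⁻¹ / 2))) ^ 2 ≤
              X₀ * ∫ x, (G x - ∫ z, G z ∂(wilsonMeasure (d := 3) (L := (F.P K).sitesPerDir 0)
                (fundamentalRep (Fin 2)) ((γ * (F.P K).eps)⁻¹ / 2))) ^ 2
                ∂(wilsonMeasure (d := 3) (L := (F.P K).sitesPerDir 0) (fundamentalRep (Fin 2)) ((γ * (F.P K).eps)⁻¹ / 2))) →
    (∃ γ₁ : ℝ, 0 < γ₁ ∧ ∀ (F : T3ContinuumYM3Torus.T3Family) (γ : ℝ), 0 < γ → γ ≤ γ₁ →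
      ∃ s₀ H₀ : ℝ, 0 < s₀ ∧ 0 ≤ H₀ ∧ ∃ K₀ : ℕ, ∀ K : ℕ, K₀ ≤ K →
        ∀ (Ω : Type) (mΩ : MeasurableSpace Ω) (P : Measure Ω) (_ : IsProbabilityMeasure P)
          (W : ℝ≥0 → Ω → (Edge 3 ((F.P K).sitesPerDir 0) × NoiseIdx 2 → ℝ)) (hW : IsFlatBrownian W P)
          (U : ℝ≥0 → Ω → GaugeConfig 3 ((F.P K).sitesPerDir 0) (Matrix.specialUnitaryGroup (Fin 2) ℂ)),
          ((∀ ω, U 0 ω = fun _ => 1) ∧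
            (latticeLangevinDynamics (⟨2, fundamentalRep (Fin 2), continuous_fundamentalRep _,
                Literature.MathematicalPhysics.QuantumLattice.fundamentalRep_injective _,
                Literature.MathematicalPhysics.QuantumLattice.fundamentalRep_mem_unitaryGroup⟩ :
                LatticeRep (Matrix.specialUnitaryGroup (Fin 2) ℂ)) ((γ * (F.P K).eps)⁻¹ / 2)).IsSolution
              (fundamentalRep (Fin 2)) hW.natFiltration P W U) →
            klDiv (Measure.map (fun ω => (fun b : PBond (F.P K) 0 => U (s₀ / (F.P K).eps).toNNReal ω (b.src, b.dir) :
                  GaugeField (F.P K) 0 (Matrix.specialUnitaryGroup (Fin 2) ℂ))) P)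
                (T4GenFunBounds.gibbsMeasure (F.P K)
                  ((F.scheme (ExpMeanLog.expMeanLogSU : LoopAverage (Matrix.specialUnitaryGroup (Fin 2) ℂ)) γ).β K))
              ≤ ENNReal.ofReal H₀) := by
  rintro ⟨γ₁, hγ₁, hB⟩
  refine ⟨γ₁, hγ₁, fun F γ hγ hγle => ?_⟩
  obtain ⟨s₀, X₀, hs₀, hX₀, K₀, hK⟩ := hB F γ hγ hγle
  refine ⟨s₀, X₀, hs₀, hX₀, K₀, fun K hKK => ?_⟩
  classical
  -- notation at the cut-off `K`
  set ε : ℝ := (F.P K).eps with hεdef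
  set Lk : ℕ := (F.P K).sitesPerDir 0 with hLk
  haveI := secondCountableTopology_su2
  haveI := borelSpace_config Lk
  set μ : Measure (GaugeConfig 3 Lk (Matrix.specialUnitaryGroup (Fin 2) ℂ)) :=
    wilsonMeasure (d := 3) (L := Lk) (fundamentalRep (Fin 2)) ((γ * ε)⁻¹ / 2) with hμ
  haveI hμP : IsProbabilityMeasure μ :=
    isProbabilityMeasure_wilsonMeasure (d := 3) (L := Lk) (fundamentalRep (Fin 2)) (continuous_fundamentalRep (Fin 2)) _
  set S := F.scheme (ExpMeanLog.expMeanLogSU : LoopAverage (Matrix.specialUnitaryGroup (Fin 2) ℂ)) γ with hS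
  have hβK : ∀ K', 0 ≤ S.β K' := fun K' => F.scheme_β_nonneg _ hγ.le K'
  set dict : GaugeConfig 3 Lk (Matrix.specialUnitaryGroup (Fin 2) ℂ) → GaugeField (F.P K) 0 (Matrix.specialUnitaryGroup (Fin 2) ℂ) :=
    fun V => fun b : PBond (F.P K) 0 => V (b.src, b.dir) with hdict
  have hΦ : Measurable dict := measurable_pi_lambda _ fun b => measurable_pi_apply _
  have hG : T4GenFunBounds.gibbsMeasure (F.P K) (S.β K) = μ.map dict :=
    gibbsMeasure_eq_map_wilsonMeasure (F.P K) (hβK K)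
  intro Ω mΩ P hP W hW U hU
  set t₀ : ℝ≥0 := (s₀ / (F.P K).eps).toNNReal with ht₀
  have hmU : Measurable (U t₀) := (hU.2.adapted t₀).mono (hW.natFiltration.le t₀) le_rfl
  have hXm : Measurable fun ω => dict (U t₀ ω) := hΦ.comp hmU
  haveI : IsProbabilityMeasure (Measure.map (fun ω => dict (U t₀ ω)) P) := Measure.isProbabilityMeasure_map hXm.aemeasurable
  haveI : IsProbabilityMeasure (μ.map dict) := Measure.isProbabilityMeasure_map hΦ.aemeasurable
  show klDiv (Measure.map (fun ω => dict (U t₀ ω)) P) (T4GenFunBounds.gibbsMeasure (F.P K) (S.β K)) ≤ ENNReal.ofReal X₀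
  rw [hG]
  refine klDiv_le_of_dual_sq_le hX₀ fun G' hG' hG'1 => ?_
  -- transport the dual bound through `dict`
  have h := hK K hKK Ω mΩ P hP W hW U hU (fun V => G' (dict V)) (hG'.comp hΦ) (fun V => hG'1 _)
  rw [integral_map hXm.aemeasurable hG'.aestronglyMeasurable, integral_map hΦ.aemeasurable hG'.aestronglyMeasurable]
  have hm2 : Measurable fun y : GaugeField (F.P K) 0 (Matrix.specialUnitaryGroup (Fin 2) ℂ) =>
      (G' y - ∫ x, G' (dict x) ∂μ) ^ 2 := (hG'.sub measurable_const).pow_const 2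
  rw [integral_map hΦ.aemeasurable hm2.aestronglyMeasurable]
  exact h

end Summit.QuantumFields.YangMills.Theorems.ColdStartUniversality

end
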